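/-
Copyright: the b2b-balaban cell (near-miss cell 7), T⁴-continuum fan-out, NE7b ROUND-2 swarm seat
`t4-ne7b-formalise-leaf-06` (row S5 of the lineage `t4-ne7b-p1` claim table `LEAVES-NE7b.md`).
Released under the licence of the surrounding project.
-/
import Summits.QuantumFields.BalabanUV.T4Continuum.Support.HistoryChrono
import Summits.QuantumFields.BalabanUV.T4Continuum.Support.HistoryAdmissible

/-!
# History chronology on the admissible skeleton (leaf H2c, part 2): `Adm K ⟹ Chrono` for the canonical label

Summits-side support leaf of the T⁴-continuum cell (rung (B)+1 on a FINITE torus only; NOT infinite volume, NOT the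
mass gap, NOT the Clay statement; NOT a proof of the spine estimate NE7b).  Row S5 «H2c chronology» of the ROUND-2 swarm
table `t4/b2b-balaban-t4-ne7b-p1/LEAVES-NE7b.md`, second file (the first, `Support/HistoryChrono.lean`, is the
carrier-generic half: `EventsLE` ∕ `Timely` ∕ `Staged`, `Timely → ZoneSkeleton.Chrono`).  [folklore] finite combinatorics
over the lineage's OWN carriers — the row owner's admissible skeleton `HistoryAdmissible.PGen` (row S1, p207789) and the
dictionary's `T4PersistenceDictionary.Gen PEv`; nothing is quoted from print, nothing printed is asserted, no `[cite:]`
tag, no `def` at all (in particular no `Prop` fact, trigger condition c1).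

WHY.  Row S1 typed the combinatorial skeleton `P : PGen γ` of a pending component's history (births, renewals of a READY
component, binary joins along print's maximal tree) with its canonical label `P.toGen : Gen PEv` and print's TIMING
DISCIPLINE `P.Adm K` («a renewal at `h + 1` happens to a component ready at `h`, hence after all its events; a join at
`s` happens after every event of both partners; everything by the cutoff `K`»).  That discipline is exactly the stage
invariant of `HistoryChrono`: the label of an admissible history, as it stands after its last event, is
`Staged PEv.step P.lastStep` — hence `Timely`, hence `Chrono`, the hypothesis `hchr` of
`ZoneReading.card_admZSet_le_of_reading` that the socket's price side consumes.  The two KIND hypotheses `hk0` ∕ `hk2`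
of the same theorem hold for the canonical label BY CONSTRUCTION (births are labelled `(j,0,d′)`, joins `(s,2,0)`),
with no admissibility hypothesis at all.

WHAT.  §1 **`staged_toGen : P.Adm K → Staged PEv.step P.lastStep P.toGen`**, `timely_toGen`,
**`chrono_toGen : P.Adm K → Chrono PEv.step P.toGen`**, `eventsLE_toGen` (every event dated `≤ K`),
`step_le_of_mem_events_toGen`, `rootStep_le_step_of_mem_events_toGen` (every event dated `≥` the root step).
§2 kinds of the canonical label, hypothesis-free: `kind_eq_zero_of_mem_births_toGen`, `kind_eq_two_of_mem_merges_toGen`,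
`kind_ne_zero_of_mem_merges_toGen`, `fat_eq_zero_of_mem_merges_toGen`.  §3 SOCKET FORM (row S5's line of the cell-tagged
socket `HistorySocketTagged.LiveHistoriesT`, whose live families are finite sets of (root cell, genealogy) pairs): if
every live pair of a cutoff `K` is labelled by an admissible history — `q.2 = P.toGen` with `P.Adm K` (the shape in
which rows S3∕S4 present the live family under the owner's ruling R-A) — then every live genealogy is `Chrono` with
kind-`0` births and kind-`2` mergers: **`chrono_of_labelled`**, **`kinds_of_labelled`**.  §4 Sanity (decided ∕ by the
theorems): the owner's `PGen.Sanity.hist` is chronological; an m1 join AT THE COMMON BIRTH STEP (two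
regions born at step `3` joined by the operations of step `3`) is admissible and chronological — the merger date equals
the root step, the boundary case of the dating discussion (journal l.5491 ∕ F-leaf05-1; it concerns `dictE`'s record
steps `> rootStep`, not chronology).

NOT DONE HERE.  Which finite families of admissible histories ARE the live structures of Bałaban's terms (H3, displayed;
rows S3∕S12 present the family); the restriction R-A (`TypeNodup ∧ RenewAtReach`) is NOT needed for chronology and is not
assumed.  NE7b discharge: no date.

HONEST DEPENDENCY (cell): continuum YM on T⁴ ⇐ BetaPertH ∧ nine spine estimates (0/9 proved); BetaPertH ⇐ (D1) ∧ (D4)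
∧ CAP+tail.  This file changes none of it.
-/

open Finset
open Literature.MathematicalPhysics.QuantumFieldTheory.Balaban1983to89
open T4PersistenceDictionary
open Summit.QuantumFields.BalabanUV.T4Continuum.PlacementSkeleton
open Summit.QuantumFields.BalabanUV.T4Continuum.Crowding
open Summit.QuantumFields.BalabanUV.T4Continuum.ZoneSkeleton
open Summit.QuantumFields.BalabanUV.T4Continuum.HistoryChrono
open Summit.QuantumFields.BalabanUV.T4Continuum.HistoryAdmissible

namespace Summit.QuantumFields.BalabanUV.T4Continuum.HistoryChronoAdmissible

variable {γ : Type*}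

/-! ## §1 The timing discipline is the stage invariant: `Adm K ⟹ Staged ⟹ Chrono` -/

/-- **AN ADMISSIBLE HISTORY'S LABEL IS STAGED AT ITS LAST STEP**: under `P.Adm K` the canonical label `P.toGen` is
`Timely` with every event dated `≤ P.lastStep` — births at their step, a renewal dated `h + 1` after a component ready
at `h ≥ lastStep`, a join dated `s ≥` both partners' last steps. [folklore] -/
theorem staged_toGen {K : ℕ} : ∀ {P : PGen γ}, P.Adm K → Staged PEv.step P.lastStep P.toGen
  | PGen.birth j d z, _ => staged_born (st := PEv.step) (b := ((j, 0, d) : PEv)) le_rfl j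
  | PGen.renew G h, hA => by
      simp only [PGen.Adm] at hA
      have ih := staged_toGen hA.1
      exact (ih.mono (show G.lastStep ≤ h + 1 by omega)).renew (e := ((h + 1, 1, 0) : PEv)) le_rfl h
  | PGen.join X Y s, hA => by
      simp only [PGen.Adm] at hA
      exact Staged.merge_eq ((staged_toGen hA.1).mono hA.2.2.1) ((staged_toGen hA.2.1).mono hA.2.2.2.1)
        (show PEv.step ((s, 2, 0) : PEv) = s from rfl)

/-- … hence timely [folklore] -/
theorem timely_toGen {K : ℕ} {P : PGen γ} (hA : P.Adm K) : Timely PEv.step P.toGen := (staged_toGen hA).timely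

/-- **ROW S5's LINE: AN ADMISSIBLE HISTORY'S CANONICAL LABEL IS CHRONOLOGICAL** — the hypothesis `hchr` of
`ZoneReading.card_admZSet_le_of_reading`. [folklore] -/
theorem chrono_toGen {K : ℕ} {P : PGen γ} (hA : P.Adm K) : Chrono PEv.step P.toGen := (staged_toGen hA).chrono

/-- under `Adm K` every event of the label is dated `≤ K` [folklore] -/
theorem eventsLE_toGen {K : ℕ} {P : PGen γ} (hA : P.Adm K) : EventsLE PEv.step K P.toGen :=
  (staged_toGen hA).eventsLE.mono (PGen.Adm.lastStep_le hA)

/-- … pointwise form [folklore] -/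
theorem step_le_of_mem_events_toGen {K : ℕ} {P : PGen γ} (hA : P.Adm K) {e : PEv} (he : e ∈ P.toGen.events) :
    e.step ≤ K :=
  eventsLE_toGen hA e he

/-- under `Adm K` every event of the label is dated no earlier than the root step («j(Z) is the index of a first
large field region contained in Z» — the root birth is the earliest event). [folklore] -/
theorem rootStep_le_step_of_mem_events_toGen {K : ℕ} :
    ∀ {P : PGen γ}, P.Adm K → ∀ e ∈ P.toGen.events, P.rootStep ≤ e.step
  | PGen.birth j d z, _, e, he => by
      simp only [PGen.toGen, Gen.events_born, mem_singleton] at he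
      subst he; exact le_rfl
  | PGen.renew G h, hA, e, he => by
      have hrl := PGen.Adm.rootStep_le_lastStep hA.1
      simp only [PGen.Adm] at hA
      simp only [PGen.toGen, Gen.events_renew, mem_insert] at he
      simp only [PGen.rootStep]
      rcases he with rfl | he
      · simp only [PEv.step_mk]; omega
      · exact rootStep_le_step_of_mem_events_toGen hA.1 e he
  | PGen.join X Y s, hA, e, he => by
      have hx := PGen.Adm.rootStep_le_lastStep hA.1
      have hy := PGen.Adm.rootStep_le_lastStep hA.2.1
      simp only [PGen.Adm] at hA
      simp only [PGen.toGen, Gen.events_merge, mem_insert, mem_union] at he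
      simp only [PGen.rootStep]
      rcases he with rfl | he | he
      · simp only [PEv.step_mk]; omega
      · exact (min_le_left _ _).trans (rootStep_le_step_of_mem_events_toGen hA.1 e he)
      · exact (min_le_right _ _).trans (rootStep_le_step_of_mem_events_toGen hA.2.1 e he)

/-! ## §2 The kinds of the canonical label (by construction, no hypothesis) -/

/-- births of the canonical label have kind `0` — the hypothesis `hk0` of `ZoneReading.card_admZSet_le_of_reading`
[folklore] -/
theorem kind_eq_zero_of_mem_births_toGen : ∀ (P : PGen γ), ∀ b ∈ births P.toGen, b.kind = 0
  | PGen.birth j d z, b, hb => by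
      simp only [PGen.toGen, births_born, mem_singleton] at hb
      subst hb; rfl
  | PGen.renew G h, b, hb => kind_eq_zero_of_mem_births_toGen G b (by simpa [PGen.toGen] using hb)
  | PGen.join X Y s, b, hb => by
      simp only [PGen.toGen, births_merge, mem_union] at hb
      rcases hb with hb | hb
      · exact kind_eq_zero_of_mem_births_toGen X b hb
      · exact kind_eq_zero_of_mem_births_toGen Y b hb

/-- mergers of the canonical label have kind `2` [folklore] -/
theorem kind_eq_two_of_mem_merges_toGen : ∀ (P : PGen γ), ∀ m ∈ merges P.toGen, m.kind = 2
  | PGen.birth j d z, m, hm => by simp [PGen.toGen, merges] at hm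
  | PGen.renew G h, m, hm => kind_eq_two_of_mem_merges_toGen G m (by simpa [PGen.toGen, merges] using hm)
  | PGen.join X Y s, m, hm => by
      simp only [PGen.toGen, merges, mem_insert, mem_union] at hm
      rcases hm with rfl | hm | hm
      · rfl
      · exact kind_eq_two_of_mem_merges_toGen X m hm
      · exact kind_eq_two_of_mem_merges_toGen Y m hm

/-- … hence are not births — the hypothesis `hk2` of `ZoneReading.card_admZSet_le_of_reading` [folklore] -/
theorem kind_ne_zero_of_mem_merges_toGen (P : PGen γ) : ∀ m ∈ merges P.toGen, m.kind ≠ 0 := fun m hm h => by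
  have := kind_eq_two_of_mem_merges_toGen P m hm; rw [h] at this; exact absurd this (by decide)

/-- mergers of the canonical label carry class `0` (the join label is `(s, 2, 0)`) [folklore] -/
theorem fat_eq_zero_of_mem_merges_toGen : ∀ (P : PGen γ), ∀ m ∈ merges P.toGen, m.fat = 0
  | PGen.birth j d z, m, hm => by simp [PGen.toGen, merges] at hm
  | PGen.renew G h, m, hm => fat_eq_zero_of_mem_merges_toGen G m (by simpa [PGen.toGen, merges] using hm)
  | PGen.join X Y s, m, hm => by
      simp only [PGen.toGen, merges, mem_insert, mem_union] at hm
      rcases hm with rfl | hm | hm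
      · rfl
      · exact fat_eq_zero_of_mem_merges_toGen X m hm
      · exact fat_eq_zero_of_mem_merges_toGen Y m hm

/-! ## §3 Socket form: live families labelled by admissible histories -/

section Socket

variable {κ δ : Type*}

/-- **CHRONOLOGY OF A LABELLED LIVE FAMILY.**  For the cell-tagged socket's live families
`live : ℕ → κ → Finset (δ × Gen PEv)` ((root cell, genealogy) pairs): if at every cutoff `K ≥ K₀` every live genealogy
is the canonical label of a history admissible up to `K`, then every live genealogy is `Chrono` — row S5's field-shaped
statement, ready for the assembly (row S12) and the price side (row S10). [folklore] -/
theorem chrono_of_labelled {K₀ : ℕ} {live : ℕ → κ → Finset (δ × Gen PEv)}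
    (hlab : ∀ K c, K₀ ≤ K → ∀ q ∈ live K c, ∃ P : PGen γ, P.Adm K ∧ P.toGen = q.2) :
    ∀ K c, K₀ ≤ K → ∀ q ∈ live K c, Chrono PEv.step q.2 := by
  intro K c hK q hq
  obtain ⟨P, hA, hP⟩ := hlab K c hK q hq
  rw [← hP]; exact chrono_toGen hA

/-- **… AND ITS KINDS**: kind-`0` births, non-birth mergers (the two kind hypotheses of the zone count), for the same
labelled family — no admissibility needed beyond the labelling. [folklore] -/
theorem kinds_of_labelled {K₀ : ℕ} {live : ℕ → κ → Finset (δ × Gen PEv)}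
    (hlab : ∀ K c, K₀ ≤ K → ∀ q ∈ live K c, ∃ P : PGen γ, P.Adm K ∧ P.toGen = q.2) :
    ∀ K c, K₀ ≤ K → ∀ q ∈ live K c, (∀ b ∈ births q.2, b.kind = 0) ∧ ∀ m ∈ merges q.2, m.kind ≠ 0 := by
  intro K c hK q hq
  obtain ⟨P, -, hP⟩ := hlab K c hK q hq
  rw [← hP]; exact ⟨kind_eq_zero_of_mem_births_toGen P, kind_ne_zero_of_mem_merges_toGen P⟩

/-- the three hypotheses `hchr`, `hk0`, `hk2` of `ZoneReading.card_admZSet_le_of_reading` AT ONCE for one admissible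
history [folklore] -/
theorem zoneCount_hyps_toGen {K : ℕ} {P : PGen γ} (hA : P.Adm K) :
    Chrono PEv.step P.toGen ∧ (∀ b ∈ births P.toGen, b.kind = 0) ∧ ∀ m ∈ merges P.toGen, m.kind ≠ 0 :=
  ⟨chrono_toGen hA, kind_eq_zero_of_mem_births_toGen P, kind_ne_zero_of_mem_merges_toGen P⟩

end Socket

/-! ## §4 Sanity -/

namespace Sanity

open PGen

/-- the owner's decided history `hist` (unit region born at `0`, joined at `3` by a class-`2` region born at `2`,
renewed at readiness `6`; `Adm 7` by `PGen.Sanity.hist_adm`) is chronological, by `chrono_toGen` [folklore] -/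
theorem hist_chrono : Chrono PEv.step PGen.Sanity.hist.toGen := chrono_toGen PGen.Sanity.hist_adm

/-- **AN m1 JOIN AT THE COMMON BIRTH STEP**: two regions born at step `3` (classes `1`, `2`, cells `5`, `9`) joined by
the operations of step `3` itself — merger date `=` root step — is admissible up to the cutoff `3` (a partner may be a
region born AT the join step) and chronological (merger dated `3 ≥ 3, 3`), by `chrono_toGen`. [folklore] -/
theorem joinAtBirth_adm_chrono :
    (PGen.join (PGen.birth 3 1 5) (PGen.birth 3 2 9) 3 : PGen ℕ).Adm 3 ∧
      Chrono PEv.step (PGen.join (PGen.birth 3 1 5) (PGen.birth 3 2 9) 3 : PGen ℕ).toGen :=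
  have hA : (PGen.join (PGen.birth 3 1 5) (PGen.birth 3 2 9) 3 : PGen ℕ).Adm 3 := by
    simp only [PGen.Adm, PGen.lastStep, le_refl, and_self]
  ⟨hA, chrono_toGen hA⟩

/-- the same chronology, decided on the unfolded label `merge (born (3,0,1) 3) (born (3,0,2) 3) (3,2,0)` [folklore] -/
example : Chrono PEv.step (Gen.merge (Gen.born ((3, 0, 1) : PEv) 3) (Gen.born (3, 0, 2) 3) (3, 2, 0)) :=
  ⟨trivial, trivial, by decide⟩

/-- its label IS that merger, whose merger event `(3,2,0)` is dated AT the root step `3` — the boundary case of the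
socket's event table `dictE` (record steps `∈ (rootStep, K]`); chronology is unaffected [folklore] -/
example : (PGen.join (PGen.birth 3 1 5) (PGen.birth 3 2 9) 3 : PGen ℕ).toGen =
      Gen.merge (Gen.born ((3, 0, 1) : PEv) 3) (Gen.born (3, 0, 2) 3) (3, 2, 0) ∧
    (PGen.join (PGen.birth 3 1 5) (PGen.birth 3 2 9) 3 : PGen ℕ).toGen.rootStep = 3 := ⟨rfl, by decide⟩

end Sanity

end Summit.QuantumFields.BalabanUV.T4Continuum.HistoryChronoAdmissible
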